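import Summits.CriticalPhenomena.PercolationContinuityZ3.Theorems.PercNearOneGluingNoHeavyLowerTailQuantitativeS5IsolatedFloorClosure
import HarnessLib

/-!
# The (S5) surplus transfer is STRICT under the explicit criterion of row M2-R22 (direction «criterion ⟹ strict»)

Support file (`--supports stmt-CriticalPhenomena-4575`), prover seat `prim-rate-mine-2` (lane prim-rate, constants-miner (c), BENCH rows
M2-R22 / M2-R22-CENSUS; `run/shared/lean/prim/prim-rate/prim-rate-mine-2/CANDIDATES.md` §gen-5, PROOFS.md §P19).  No definitions, no named
facts, no sorries; standard axioms.

Setting: an arbitrary finite weighted graph (all weights `< 1`; for the connection criterion: non-degenerate weights on their support `E`,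
i.e. `w = 0` off `E` and `0 < w < 1` on `E`), relay set `T` with an injective rank `r` STRICTLY compatible with the relay means at `w`
(`r a < r a' → m_a < m_{a'}`), observers `o ≠ v` off `T`, `D = []`.  The (S5) margin `s5dMargin w T r [] o v F = Sur_o(T) − p·Sur_v(T)` dominates the
graph-explicit floor of row M2-R21 on such graphs (`CSH.s5dMargin_ge_sum_rankGain_add_isolatedFloor_of_lt_one`), a sum over the relays `a` of
the nonnegative terms `γ_a·q_a` and `∏_{e ∩ T_{<a} ≠ ∅}(1 − w_e)·Cov_{w_{T<a}}(F(Ĉ_a), 1_{U_a})`, `U_a = {o ↔ {a} ∪ T_{>a}} ∪ {o↔v}`.  Hence: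

* `CSH.s5dMargin_nil_pos_of_rankGain_mul_avoidConst_pos` — `F` monotone nonnegative: if some relay has `γ_a > 0` and `q_a > 0` (positive rank gain
  AND `o` attachable to `a` away from the other relays and `v`), then `0 < s5dMargin w T r [] o v F`;
* `CSH.s5dMargin_nil_pos_of_exists_pivotal` — `F = 1{b ∈ ·}`: if for some relay `a` some pair of `E` missing `T_{<a}` is pivotal, at configurations
  inside `E − pairs(T_{<a})`, both for `{a ↔ b}` and for `U_a` (equivalently: lies on a simple `a–b` path and on a simple path from `o` to
  `{a} ∪ T_{>a} ∪ {v}` of the support graph with the earlier relays deleted), then `0 < s5dMargin w T r [] o v 1{b ∈ ·}` — the equality case of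
  Harris (`QuantHarris.cov_pos_iff_exists_pivotal`, row M2-R17) in the «earlier relays isolated» world.

Together: the disjunction «∃ a ∈ T: (γ_a > 0 ∧ q_a > 0) ∨ common pivotal pair in Γ − T_{<a}» implies strictness of (S5) — row M2-R22 (⟸).  The
converse (vanishing off the criterion) is the lane's exact census finding (327 116 instances on all connected support graphs with ≤ 6 vertices,
0 exceptions; BENCH row M2-R22-CENSUS) and is not claimed here.
[cite: KozmaNitzan2024, Conj. 4 (p. 32)] [cite: Harris1960, Lemma 4.1 (p. 16)] [cite: VandenbergHaggstromKahn2005, §2.1 (pp. 9–13)]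
-/

noncomputable section

namespace Summit.CriticalPhenomena.PercolationContinuityZ3.Theorems

open MeasureTheory Set Filter Topology Literature.Probability.LatticeModels Literature.Probability.Percolation
open scoped Classical

namespace CSH

variable {n : ℕ}

/-- Every term of the graph-explicit (S5) floor is nonnegative: `γ_a ≥ 0` (compatible rank), `q_a ≥ 0`, `∏(1 − w_e) ≥ 0` and the «`Y` isolated»
Harris covariance `≥ 0` (Harris in the product measure `prodBernoulli w_Y`). [cite: Harris1960, Lemma 4.1 (p. 16)] -/
theorem isolatedFloor_term_nonneg (w : Sym2 (Fin n) → unitInterval) (o v : Fin n) (T : Finset (Fin n)) (r : Fin n → ℕ)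
    (F : Set (Fin n) → ℝ) (hF : ∀ S S' : Set (Fin n), S ⊆ S' → F S ≤ F S') (hF0 : ∀ S : Set (Fin n), 0 ≤ F S)
    (hcompat : ∀ a ∈ T, ∀ a' ∈ T, r a < r a' →
      ∫ ω, F (openCluster ω a) ∂(prodBernoulli w) ≤ ∫ ω, F (openCluster ω a') ∂(prodBernoulli w))
    (a : Fin n) (ha : a ∈ T) :
    0 ≤ rankGain w T r F a * avoidConst w a ((↑(T.erase a) : Set (Fin n)) ∪ ({d | d ∈ ([] : List (Fin n))} ∪ {v})) o ∧
    0 ≤ (∏ e ∈ Finset.univ.filter (fun e : Sym2 (Fin n) => ∃ y ∈ (↑(T.filter (fun b => r b < r a)) : Set (Fin n)), y ∈ e), (1 - (w e : ℝ))) *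
          ((∫ η in ((⋃ t ∈ (insert a (T.filter (fun b => r a < r b) ∪ ([] : List (Fin n)).toFinset)), openConn o t) ∪ openConn o v),
              F {c | c = a ∨ ∃ e ∈ openEdgeCluster η a, c ∈ e}
              ∂(prodBernoulli fun e => if (∃ y ∈ (↑(T.filter (fun b => r b < r a)) : Set (Fin n)), y ∈ e) then (0 : unitInterval) else w e)) -
            (prodBernoulli fun e => if (∃ y ∈ (↑(T.filter (fun b => r b < r a)) : Set (Fin n)), y ∈ e) then (0 : unitInterval) else w e).real
                ((⋃ t ∈ (insert a (T.filter (fun b => r a < r b) ∪ ([] : List (Fin n)).toFinset)), openConn o t) ∪ openConn o v) *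
              (∫ η, F {c | c = a ∨ ∃ e ∈ openEdgeCluster η a, c ∈ e}
                ∂(prodBernoulli fun e => if (∃ y ∈ (↑(T.filter (fun b => r b < r a)) : Set (Fin n)), y ∈ e) then (0 : unitInterval) else w e))) := by
  refine ⟨mul_nonneg (rankGain_nonneg w T r F a fun a' ha' hlt => hcompat a' ha' a ha hlt) ?_, mul_nonneg ?_ ?_⟩
  · unfold avoidConst
    exact div_nonneg measureReal_nonneg measureReal_nonneg
  · exact Finset.prod_nonneg fun e _ => sub_nonneg.2 (w e).2.2
  · refine harrisTerm_clusterFun_nonneg _ a _ ?_ F hF hF0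
    rintro ω ω' hle (h | h)
    · obtain ⟨t, ht, h⟩ := Set.mem_iUnion₂.1 h
      exact Or.inl (Set.mem_iUnion₂.2 ⟨t, ht, SimpleGraph.Reachable.mono (BHK2006.openGraph_le hle) h⟩)
    · exact Or.inr (SimpleGraph.Reachable.mono (BHK2006.openGraph_le hle) h)

/-- **(S5) is strict when some relay has positive rank gain and `o` attaches to it away from the other named vertices.**  All weights
`< 1`, `F` monotone nonnegative, injective rank strictly compatible at `w`, `o ≠ v` off `T`; if `a ∈ T` has `0 < γ_a = rankGain w T r F a` and
`0 < q_a = μ(o ∈ C_a | a ↮ (T∖a) ∪ {v})`, then `0 < s5dMargin w T r [] o v F`.  BENCH row M2-R22 (⟸, first disjunct).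
[cite: KozmaNitzan2024, Conj. 4 (p. 32)] -/
theorem s5dMargin_nil_pos_of_rankGain_mul_avoidConst_pos (w : Sym2 (Fin n) → unitInterval) (hw : ∀ e, w e < 1) (o v : Fin n)
    (hov : o ≠ v) (T : Finset (Fin n)) (r : Fin n → ℕ) (F : Set (Fin n) → ℝ)
    (hF : ∀ S S' : Set (Fin n), S ⊆ S' → F S ≤ F S') (hF0 : ∀ S : Set (Fin n), 0 ≤ F S) (hr : Set.InjOn r ↑T)
    (hstrict : ∀ a ∈ T, ∀ a' ∈ T, r a < r a' →
      ∫ ω, F (openCluster ω a) ∂(prodBernoulli w) < ∫ ω, F (openCluster ω a') ∂(prodBernoulli w))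
    (hoT : o ∉ T) (hvT : v ∉ T) (a : Fin n) (ha : a ∈ T) (hγ : 0 < rankGain w T r F a)
    (hq : 0 < avoidConst w a ((↑(T.erase a) : Set (Fin n)) ∪ ({d | d ∈ ([] : List (Fin n))} ∪ {v})) o) :
    0 < s5dMargin w T r [] o v F := by
  have hfloor := s5dMargin_ge_sum_rankGain_add_isolatedFloor_of_lt_one w hw o v hov T r F hF hF0 hr hstrict hoT hvT
  have hcompat : ∀ a ∈ T, ∀ a' ∈ T, r a < r a' →
      ∫ ω, F (openCluster ω a) ∂(prodBernoulli w) ≤ ∫ ω, F (openCluster ω a') ∂(prodBernoulli w) :=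
    fun a ha a' ha' hlt => (hstrict a ha a' ha' hlt).le
  have hnn := fun a' (ha' : a' ∈ T) => isolatedFloor_term_nonneg w o v T r F hF hF0 hcompat a' ha'
  have hsingle := Finset.single_le_sum (fun a' ha' => add_nonneg (hnn a' ha').1 (hnn a' ha').2) ha
  have hterm : 0 < rankGain w T r F a * avoidConst w a ((↑(T.erase a) : Set (Fin n)) ∪ ({d | d ∈ ([] : List (Fin n))} ∪ {v})) o :=
    mul_pos hγ hq
  linarith [(hnn a ha).2]

/-- **(S5) is strict for `F = 1{b ∈ ·}` when, for some relay `a`, the support graph with the earlier relays deleted has a pair pivotal both for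
`{a ↔ b}` and for `{o ↔ {a} ∪ T_{>a}} ∪ {o ↔ v}`.**  Weights non-degenerate on their support `E`; injective rank strictly compatible at `w`;
`o ≠ v` off `T`; `E_a := {f ∈ E : f ∩ T_{<a} = ∅}`.  BENCH row M2-R22 (⟸, second disjunct): the equality case of Harris (row M2-R17) in the
«earlier relays isolated» world of the floor. [cite: Harris1960, Lemma 4.1 (p. 16)] [cite: KozmaNitzan2024, Conj. 4 (p. 32)] -/
theorem s5dMargin_nil_pos_of_exists_pivotal (w : Sym2 (Fin n) → unitInterval) (E : Set (Sym2 (Fin n)))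
    (hE0 : ∀ f, f ∉ E → (w f : ℝ) = 0) (hE1 : ∀ f ∈ E, 0 < (w f : ℝ) ∧ (w f : ℝ) < 1) (o v b : Fin n)
    (hov : o ≠ v) (T : Finset (Fin n)) (r : Fin n → ℕ) (hr : Set.InjOn r ↑T)
    (hstrict : ∀ a ∈ T, ∀ a' ∈ T, r a < r a' →
      ∫ ω, (fun S : Set (Fin n) => if b ∈ S then (1 : ℝ) else 0) (openCluster ω a) ∂(prodBernoulli w) <
        ∫ ω, (fun S : Set (Fin n) => if b ∈ S then (1 : ℝ) else 0) (openCluster ω a') ∂(prodBernoulli w))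
    (hoT : o ∉ T) (hvT : v ∉ T) (a : Fin n) (ha : a ∈ T)
    (hcrit : ∃ e ∈ E, (∀ y ∈ T.filter (fun b' => r b' < r a), y ∉ e) ∧
      (∃ η : Set (Sym2 (Fin n)), η ⊆ {f | f ∈ E ∧ ∀ y ∈ T.filter (fun b' => r b' < r a), y ∉ f} ∧
        insert e η ∈ (openConn a b : Set (BondConfig (Fin n))) ∧ η \ {e} ∉ (openConn a b : Set (BondConfig (Fin n)))) ∧
      (∃ η : Set (Sym2 (Fin n)), η ⊆ {f | f ∈ E ∧ ∀ y ∈ T.filter (fun b' => r b' < r a), y ∉ f} ∧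
        insert e η ∈ (((⋃ t ∈ (insert a (T.filter (fun b' => r a < r b') ∪ ([] : List (Fin n)).toFinset)), openConn o t) ∪ openConn o v :
          Set (BondConfig (Fin n)))) ∧
        η \ {e} ∉ (((⋃ t ∈ (insert a (T.filter (fun b' => r a < r b') ∪ ([] : List (Fin n)).toFinset)), openConn o t) ∪ openConn o v :
          Set (BondConfig (Fin n)))))) :
    0 < s5dMargin w T r [] o v (fun S : Set (Fin n) => if b ∈ S then (1 : ℝ) else 0) := by
  set F : Set (Fin n) → ℝ := fun S => if b ∈ S then (1 : ℝ) else 0 with hFdef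
  set Y : Set (Fin n) := (↑(T.filter (fun b' => r b' < r a)) : Set (Fin n)) with hY
  set U : Set (BondConfig (Fin n)) :=
    (⋃ t ∈ (insert a (T.filter (fun b' => r a < r b') ∪ ([] : List (Fin n)).toFinset)), openConn o t) ∪ openConn o v with hU
  set qY : Sym2 (Fin n) → unitInterval := fun e => if (∃ y ∈ Y, y ∈ e) then (0 : unitInterval) else w e with hqY
  set EY : Set (Sym2 (Fin n)) := {f | f ∈ E ∧ ∀ y ∈ T.filter (fun b' => r b' < r a), y ∉ f} with hEY
  have hmeas : ∀ S : Set (BondConfig (Fin n)), MeasurableSet S := fun _ => MeasurableSet.of_discrete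
  have hw1r : ∀ e, (w e : ℝ) < 1 := by
    intro e
    by_cases he : e ∈ E
    · exact (hE1 e he).2
    · rw [hE0 e he]; norm_num
  have hw : ∀ e, w e < 1 := fun e => by
    have h := hw1r e
    exact Subtype.coe_lt_coe.1 (by simpa using h)
  have hF : ∀ S S' : Set (Fin n), S ⊆ S' → F S ≤ F S' := by
    intro S S' hSS'
    simp only [hFdef]
    by_cases h : b ∈ S
    · rw [if_pos h, if_pos (hSS' h)]
    · rw [if_neg h]; split_ifs <;> norm_num
  have hF0 : ∀ S : Set (Fin n), 0 ≤ F S := fun S => by simp only [hFdef]; split_ifs <;> norm_num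
  have hfloor := s5dMargin_ge_sum_rankGain_add_isolatedFloor_of_lt_one w hw o v hov T r F hF hF0 hr hstrict hoT hvT
  have hcompat : ∀ a ∈ T, ∀ a' ∈ T, r a < r a' →
      ∫ ω, F (openCluster ω a) ∂(prodBernoulli w) ≤ ∫ ω, F (openCluster ω a') ∂(prodBernoulli w) :=
    fun a ha a' ha' hlt => (hstrict a ha a' ha' hlt).le
  have hnn := fun a' (ha' : a' ∈ T) => isolatedFloor_term_nonneg w o v T r F hF hF0 hcompat a' ha'
  have hsingle := Finset.single_le_sum (fun a' ha' => add_nonneg (hnn a' ha').1 (hnn a' ha').2) ha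
  -- the isolated Harris term of `a` is a covariance of two up-sets under `prodBernoulli qY`
  have hFind : (fun η : BondConfig (Fin n) => F {c | c = a ∨ ∃ e ∈ openEdgeCluster η a, c ∈ e}) =
      (openConn a b : Set (BondConfig (Fin n))).indicator fun _ => (1 : ℝ) := by
    funext η
    have hiff : η ∈ (openConn a b : Set (BondConfig (Fin n))) ↔ (b = a ∨ ∃ e ∈ openEdgeCluster η a, b ∈ e) :=
      reachable_iff_exists_mem_openEdgeCluster η a b
    simp only [hFdef, mem_setOf_eq]
    by_cases hη : (b = a ∨ ∃ e ∈ openEdgeCluster η a, b ∈ e)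
    · rw [if_pos hη, Set.indicator_of_mem (hiff.2 hη)]
    · rw [if_neg hη, Set.indicator_of_notMem (fun h' => hη (hiff.1 h'))]
  have hUup : ∀ ω ω' : BondConfig (Fin n), ω ⊆ ω' → ω ∈ U → ω' ∈ U := by
    rintro ω ω' hle (h | h)
    · obtain ⟨t, ht, h⟩ := Set.mem_iUnion₂.1 h
      exact Or.inl (Set.mem_iUnion₂.2 ⟨t, ht, SimpleGraph.Reachable.mono (BHK2006.openGraph_le hle) h⟩)
    · exact Or.inr (SimpleGraph.Reachable.mono (BHK2006.openGraph_le hle) h)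
  have hBup : ∀ ω ω' : BondConfig (Fin n), ω ⊆ ω' → ω ∈ (openConn a b : Set (BondConfig (Fin n))) →
      ω' ∈ (openConn a b : Set (BondConfig (Fin n))) :=
    fun _ _ hle h => SimpleGraph.Reachable.mono (BHK2006.openGraph_le hle) h
  have hcov : (∫ η in U, F {c | c = a ∨ ∃ e ∈ openEdgeCluster η a, c ∈ e} ∂(prodBernoulli qY)) -
      (prodBernoulli qY).real U * (∫ η, F {c | c = a ∨ ∃ e ∈ openEdgeCluster η a, c ∈ e} ∂(prodBernoulli qY)) =
      (prodBernoulli qY).real (U ∩ openConn a b) - (prodBernoulli qY).real U * (prodBernoulli qY).real (openConn a b) := by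
    rw [hFind, integral_indicator (hmeas _), integral_indicator (hmeas _), Measure.restrict_restrict (hmeas _)]
    simp only [integral_const, smul_eq_mul, mul_one, measureReal_restrict_apply_univ]
    rw [Set.inter_comm]
  -- the zeroed weights are non-degenerate exactly on `EY`
  have hq0 : ∀ e, e ∉ EY → ((qY e : unitInterval) : ℝ) = 0 := by
    intro e he
    simp only [hqY]
    by_cases hc : ∃ y ∈ Y, y ∈ e
    · rw [if_pos hc]; rfl
    · rw [if_neg hc]
      apply hE0 e
      intro heE
      apply he
      refine ⟨heE, fun y hy hye => hc ⟨y, ?_, hye⟩⟩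
      rw [hY, Finset.mem_coe]; exact hy
  have hq1 : ∀ e ∈ EY, 0 < ((qY e : unitInterval) : ℝ) ∧ ((qY e : unitInterval) : ℝ) < 1 := by
    intro e he
    have hc : ¬ ∃ y ∈ Y, y ∈ e := by
      rintro ⟨y, hy, hye⟩
      rw [hY, Finset.mem_coe] at hy
      exact he.2 y hy hye
    simp only [hqY]
    rw [if_neg hc]
    exact hE1 e he.1
  have hcovpos : 0 < (prodBernoulli qY).real (U ∩ openConn a b) -
      (prodBernoulli qY).real U * (prodBernoulli qY).real (openConn a b) := by
    obtain ⟨e, heE, heY, hpB, hpU⟩ := hcrit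
    have h := (QuantHarris.cov_pos_iff_exists_pivotal qY EY hq0 hq1 U (openConn a b) hUup hBup).2 ⟨e, ⟨heE, heY⟩, hpU, hpB⟩
    linarith
  have hprodpos : 0 < ∏ e ∈ Finset.univ.filter (fun e : Sym2 (Fin n) => ∃ y ∈ Y, y ∈ e), (1 - (w e : ℝ)) :=
    Finset.prod_pos fun e _ => by linarith [hw1r e]
  have hiso : 0 < (∏ e ∈ Finset.univ.filter (fun e : Sym2 (Fin n) => ∃ y ∈ Y, y ∈ e), (1 - (w e : ℝ))) *
      ((∫ η in U, F {c | c = a ∨ ∃ e ∈ openEdgeCluster η a, c ∈ e} ∂(prodBernoulli qY)) -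
        (prodBernoulli qY).real U * (∫ η, F {c | c = a ∨ ∃ e ∈ openEdgeCluster η a, c ∈ e} ∂(prodBernoulli qY))) := by
    rw [hcov]; exact mul_pos hprodpos hcovpos
  linarith [(hnn a ha).1]

end CSH

end Summit.CriticalPhenomena.PercolationContinuityZ3.Theorems
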